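import Literature.Analysis.FluidPDE.PeriodicCylinderNeumannCovariance
import Literature.Analysis.FluidPDE.WeakDerivAlong
import HarnessLib

/-!
# Difference quotients along the symmetries of the period cell, and the weak derivatives they
produce

Topic `Literature/Analysis/FluidPDE`. Theorem-only file (no definitions, no named facts) of the
regularity theory for the periodic Neumann problem on the cylinder `{r ≤ 1} × ℝ/Lℤ`
(`PeriodicCylinderHelmholtz`, `PeriodicCylinderSymmetry`, `PeriodicCylinderNeumannCovariance`), the
analytic input of the local existence theorem for the Euler equations in the periodic cylinder
(T. Kato, C. Y. Lai, J. Funct. Anal. **56** (1984), Thm I/II; the tree's named fact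
`Literature.Analysis.FluidPDE.KatoLai1984_periodicCylinderUniformExistence`). It supplies the
analytic half of Nirenberg's method of difference quotients along the symmetries (CPAM 8 (1955);
Kato–Lai's [11]) in the `L²(cell)` setting of the tree: **`L²`-convergent difference quotients
along a one-parameter group of symmetries of the cell give a weak derivative along its generator**
(in the sense of `HasWeakDerivAlong`, `WeakDerivAlong.lean`):

* `hasWeakDerivAlong_eZ_of_tendsto` — if `aₙ → 0`, `aₙ ≠ 0` and `aₙ⁻¹(U_{aₙ} f − f) → f'` in
  `L²(cell; E)` for the periodic axial shifts `U_a` (`axialShiftLp`), then `f'` is a weak derivative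
  of `f` along `e_z` on the open cell;
* `hasWeakDerivAlong_rotGen_of_tendsto` — the same for the rotations `R_θ f = f ∘ R_θ` (`rotLp`) and
  the generator `J x = (−x₁, x₀, 0)` (`rotGen`, divergence free).

Proof (both): against a test function `φ` on the cell, the quotients `ψₙ = (φ − φ ∘ γ(−tₙ))/tₙ`
(`γ` the flow through `x`) converge pointwise to `Dφ(X)` (`tendsto_diffQuot_comp_curve`) under a
uniform bound (`abs_diffQuot_comp_curve_le`: mean value along the flow line, speed `1`, resp.
`r(x) < 1` on the cell), so `∫ ψₙ • f → ∫ Dφ(X) • f` by dominated convergence; on the other hand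
the symmetry is **transferred from the test function to `f`**,
`∫_cell φ(x − a e_z) • f(x) dx = ∫_cell φ • U_a f` for `|a|` below the axial margin of `tsupport φ`
(`exists_forall_setIntegral_comp_sub_smul`: replace `φ` by its periodisation, which agrees with
`φ(· − a e_z)` on the cell for small `a` — `exists_margin_periodize` —, then change variables with
the measure-preserving `cellShift`), resp. `∫_cell φ(R_{−θ}x) • f(x) dx = ∫_cell φ • R_θ f`
exactly (`setIntegral_comp_rotZ_neg_smul`), so that `∫ ψₙ • f = −∫ φ • tₙ⁻¹(U_{tₙ} f − f) → −∫ φ • f'`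
(`tendsto_setIntegral_smul_of_tendsto`: `g ↦ ∫ φ • g` is `L²`-continuous, by `L¹ ≤ L²` on the
finite cell, `setIntegral_norm_le_mul_norm`). Uniqueness of limits gives the tested identity.

## What is NOT here

The convergence of the difference quotients of the weak Neumann solution with smooth data (by the
covariance of the problem and the continuity of the solution map) — the sequel file; anything
about second derivatives.

Mathlib/tree search: tree — `axialShiftLp`, `rotLp`, `cellShift`, `periodize`, `contDiff_periodize`,
`exists_axial_margin`, `integral_comp_cellShift`, `integral_comp_rotZ_cell`, `cellShift_cellShift`
(preceding files), `hasDerivAt_rotZ`, `hasDerivAt_rotZ_zero`, `rotGen`, `norm_rotGen_eq_cylRadius`,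
`divergence_rotGen_eq_zero`, `HasWeakDerivAlong` (+ `integrableOn_smul`, `divergence_const_field`);
Mathlib — `tendsto_integral_of_dominated_convergence`, `HasDerivAt.tendsto_slope_zero`,
`Convex.norm_image_sub_le_of_norm_deriv_le`, `Integrable.smul_of_top_right`, `memLp_top_of_bound`,
`tendsto_nhds_unique`, `Int.floor_eq_iff`. No difference-quotient-to-weak-derivative statement
existed in the tree (`lean search 'difference quotient|diffQuot'`: finite-difference material on
lattices only).

## References

* L. Nirenberg, Comm. Pure Appl. Math. 8 (1955) 649–675 (difference quotients). [folklore]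
* L. C. Evans, *Partial Differential Equations*, 2nd ed. (2010), §5.8.2 Thm 3 (difference quotients
  and weak derivatives). [Evans2010]
* T. Kato, C. Y. Lai, J. Funct. Anal. 56 (1984) 15–28, §5. [KatoLai1984]
-/

noncomputable section

open MeasureTheory Set Function Filter Topology TopologicalSpace WithLp Metric
open scoped ContDiff NNReal ENNReal InnerProductSpace RealInnerProductSpace

namespace Literature.Analysis.FluidPDE

open Literature.Analysis.FunctionSpaces

/-- Local notation for physical space `ℝ³ = EuclideanSpace ℝ (Fin 3)`. -/
local notation "ℝ³" => EuclideanSpace ℝ (Fin 3)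

/-- Local notation for the closed unit cylinder `{r ≤ 1}`. -/
local notation "𝕂" => closure (SetLike.coe unitCylinder : Set (EuclideanSpace ℝ (Fin 3)))

namespace PeriodicCylinder

variable {L : ℝ}
variable {E : Type*} [NormedAddCommGroup E]

/-! ### Integrals against a bounded factor are continuous on `L²(cell)` -/

/-- **`L¹ ≤ L²` on the cell**: `∫_cell ‖h‖ ≤ ‖[1]‖ ‖h‖_{L²(cell)}` (Cauchy–Schwarz against the class
of `1`). [folklore] -/
theorem setIntegral_norm_le_mul_norm (h : Lp E 2 (cellMeasure L)) :
    ∫ x in (cylinderCell L : Set ℝ³), ‖h x‖ ≤ ‖toCell L (fun _ : ℝ³ => (1 : ℝ))‖ * ‖h‖ := by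
  have hn : MemLp (fun x => ‖(h : ℝ³ → E) x‖) 2 (cellMeasure L) := (Lp.memLp h).norm
  have h1 : MemLp (fun _ : ℝ³ => (1 : ℝ)) 2 (cellMeasure L) := (isSmoothPeriodic_const (L := L) (1 : ℝ)).memLp
  have hinner : ⟪toCell L (fun _ : ℝ³ => (1 : ℝ)), toCell L (fun x => ‖(h : ℝ³ → E) x‖)⟫ =
      ∫ x in (cylinderCell L : Set ℝ³), ‖h x‖ := by
    rw [inner_toCell_toCell h1 hn]
    exact integral_congr_ae (Eventually.of_forall fun x => by simp)
  rw [← hinner]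
  refine (real_inner_le_norm _ _).trans ?_
  gcongr
  rw [norm_toCell hn, Lp.norm_def h, eLpNorm_norm]

/-- **Continuity of `g ↦ ∫_cell φ • g` on `L²(cell)`** for a bounded measurable factor `φ`. [folklore] -/
theorem tendsto_setIntegral_smul_of_tendsto [NormedSpace ℝ E] [CompleteSpace E] {φ : ℝ³ → ℝ} (hφm : AEStronglyMeasurable φ (cellMeasure L))
    {M : ℝ} (hM : ∀ x, |φ x| ≤ M) {ι : Type*} {l : Filter ι} {g : ι → Lp E 2 (cellMeasure L)}
    {g' : Lp E 2 (cellMeasure L)} (h : Tendsto g l (𝓝 g')) :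
    Tendsto (fun n => ∫ x in (cylinderCell L : Set ℝ³), φ x • g n x) l
      (𝓝 (∫ x in (cylinderCell L : Set ℝ³), φ x • g' x)) := by
  have hM0 : 0 ≤ M := (abs_nonneg _).trans (hM 0)
  rw [tendsto_iff_norm_sub_tendsto_zero]
  -- `‖∫ φ•gₙ − ∫ φ•g'‖ ≤ M ‖[1]‖ ‖gₙ − g'‖`
  have hint : ∀ w : Lp E 2 (cellMeasure L), Integrable (fun x => φ x • (w : ℝ³ → E) x) (cellMeasure L) :=
    fun w => ((Lp.memLp w).integrable one_le_two).smul_of_top_right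
      (memLp_top_of_bound hφm M (Eventually.of_forall fun x => by rw [Real.norm_eq_abs]; exact hM x))
  have hbound : ∀ n, ‖(∫ x in (cylinderCell L : Set ℝ³), φ x • g n x) -
      ∫ x in (cylinderCell L : Set ℝ³), φ x • g' x‖ ≤
      M * ‖toCell L (fun _ : ℝ³ => (1 : ℝ))‖ * ‖g n - g'‖ := fun n => by
    rw [← integral_sub (hint (g n)) (hint g')]
    have hae : (fun x => φ x • (g n : ℝ³ → E) x - φ x • (g' : ℝ³ → E) x) =ᵐ[cellMeasure L]
        fun x => φ x • ((g n - g' : Lp E 2 (cellMeasure L)) : ℝ³ → E) x := by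
      filter_upwards [Lp.coeFn_sub (g n) g'] with x hx
      rw [hx, Pi.sub_apply, smul_sub]
    rw [integral_congr_ae hae]
    refine (norm_integral_le_integral_norm _).trans ?_
    have h2 : ∫ x in (cylinderCell L : Set ℝ³), ‖φ x • ((g n - g' : Lp E 2 (cellMeasure L)) : ℝ³ → E) x‖ ≤
        ∫ x in (cylinderCell L : Set ℝ³), M * ‖((g n - g' : Lp E 2 (cellMeasure L)) : ℝ³ → E) x‖ := by
      refine integral_mono_of_nonneg (Eventually.of_forall fun x => norm_nonneg _)
        (((Lp.memLp (g n - g')).integrable one_le_two).norm.const_mul M)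
        (Eventually.of_forall fun x => ?_)
      show ‖φ x • ((g n - g' : Lp E 2 (cellMeasure L)) : ℝ³ → E) x‖ ≤
        M * ‖((g n - g' : Lp E 2 (cellMeasure L)) : ℝ³ → E) x‖
      rw [norm_smul, Real.norm_eq_abs]
      exact mul_le_mul_of_nonneg_right (hM x) (norm_nonneg _)
    refine h2.trans ?_
    rw [integral_const_mul, mul_assoc]
    exact mul_le_mul_of_nonneg_left (setIntegral_norm_le_mul_norm _) hM0
  have hlim : Tendsto (fun n => M * ‖toCell L (fun _ : ℝ³ => (1 : ℝ))‖ * ‖g n - g'‖) l (𝓝 0) := by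
    have := (tendsto_iff_norm_sub_tendsto_zero.1 h).const_mul (M * ‖toCell L (fun _ : ℝ³ => (1 : ℝ))‖)
    rwa [mul_zero] at this
  exact squeeze_zero (fun n => norm_nonneg _) hbound hlim

/-! ### Difference quotients of a test function -/

/-- A test function has bounded derivative. [folklore] -/
theorem exists_forall_norm_fderiv_le {φ : ℝ³ → ℝ} (hφ : ContDiff ℝ ∞ φ) (hφc : HasCompactSupport φ) :
    ∃ M : ℝ, 0 ≤ M ∧ ∀ x, ‖fderiv ℝ φ x‖ ≤ M := by
  have hc : Continuous (fderiv ℝ φ) := hφ.continuous_fderiv (by simp)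
  obtain ⟨M, hM⟩ := (hφc.fderiv (𝕜 := ℝ)).exists_bound_of_continuous hc
  exact ⟨max M 0, le_max_right _ _, fun x => (hM x).trans (le_max_left _ _)⟩

/-- **Pointwise convergence of difference quotients along a curve through `x`**: if `γ(0) = x` and
`γ` has velocity `v` at `0`, then `(φ(x) − φ(γ(−t)))/t → Dφ(x) v` as `t → 0`, `t ≠ 0`. [folklore] -/
theorem tendsto_diffQuot_comp_curve {φ : ℝ³ → ℝ} (hφ : Differentiable ℝ φ) {x : ℝ³} {γ : ℝ → ℝ³}
    {v : ℝ³} (hγ0 : γ 0 = x) (hγ : HasDerivAt γ v 0) :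
    Tendsto (fun t : ℝ => (φ x - φ (γ (-t))) / t) (𝓝[≠] 0) (𝓝 (fderiv ℝ φ x v)) := by
  -- `k t := φ (γ (-t))` has derivative `-Dφ(x) v` at `0`
  have hk : HasDerivAt (fun t : ℝ => φ (γ (-t))) (-(fderiv ℝ φ x v)) 0 := by
    have h1 : HasDerivAt (fun t : ℝ => γ (-t)) (-v) 0 := by
      have hγ' : HasDerivAt γ v (-(0 : ℝ)) := by rwa [neg_zero]
      have h := hγ'.scomp (0 : ℝ) (hasDerivAt_neg (0 : ℝ))
      simp only [neg_one_smul] at h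
      exact h
    have h2 := (hφ (γ (-0))).hasFDerivAt.comp_hasDerivAt (0 : ℝ) h1
    simp only [neg_zero, hγ0, map_neg] at h2
    exact h2
  have hs := hk.tendsto_slope_zero
  -- `slope at 0`: `t⁻¹ (k t - k 0) → -Dφ v`; our quotient is its negative
  have heq : ∀ t : ℝ, (φ x - φ (γ (-t))) / t = -(t⁻¹ • (φ (γ (-(0 + t))) - φ (γ (-0)))) := fun t => by
    simp only [zero_add, neg_zero, hγ0, smul_eq_mul]
    field_simp
    ring
  simp_rw [heq]
  simpa using hs.neg

/-- **Domination of difference quotients along a curve**: if `‖Dφ‖ ≤ M` everywhere and the curve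
`s ↦ γ(s)` is differentiable with speed `≤ V` then `|(φ(γ 0) − φ(γ(−t)))/t| ≤ M V`. [folklore] -/
theorem abs_diffQuot_comp_curve_le {φ : ℝ³ → ℝ} (hφ : Differentiable ℝ φ) {M : ℝ}
    (hM : ∀ y, ‖fderiv ℝ φ y‖ ≤ M) {γ : ℝ → ℝ³} {V : ℝ} (hγ : ∀ s, DifferentiableAt ℝ γ s)
    (hV : ∀ s, ‖deriv γ s‖ ≤ V) {t : ℝ} (ht : t ≠ 0) :
    |(φ (γ 0) - φ (γ (-t))) / t| ≤ M * V := by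
  have hM0 : 0 ≤ M := (norm_nonneg _).trans (hM 0)
  -- the composite `k = φ ∘ γ` has `|k'| ≤ M V`
  have hk : ∀ s, HasDerivAt (fun s => φ (γ s)) (fderiv ℝ φ (γ s) (deriv γ s)) s := fun s =>
    (hφ (γ s)).hasFDerivAt.comp_hasDerivAt s (hγ s).hasDerivAt
  have hk' : ∀ s, ‖deriv (fun s => φ (γ s)) s‖ ≤ M * V := fun s => by
    rw [(hk s).deriv]
    exact ((fderiv ℝ φ (γ s)).le_opNorm _).trans (mul_le_mul (hM _) (hV s) (norm_nonneg _) hM0)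
  have hmv := Convex.norm_image_sub_le_of_norm_deriv_le (f := fun s => φ (γ s))
    (fun s _ => (hk s).differentiableAt) (fun s _ => hk' s) convex_univ (mem_univ (-t)) (mem_univ 0)
  rw [Real.norm_eq_abs, Real.norm_eq_abs, sub_neg_eq_add, zero_add] at hmv
  rw [abs_div]
  rw [div_le_iff₀ (abs_pos.2 ht)]
  linarith [hmv]

/-! ### Transferring the periodic shift from the function to the test function -/

/-- **Margin**: for a test function `φ` on the cell there is `δ > 0` such that for `|a| < δ` and
`x` in the cell, `φ(x − a e_z) = (periodize φ)(x − a e_z)` — either `x − a e_z` lies in the cell,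
or both vanish because `x − a e_z` and its reduction are within `δ` of an end face. [folklore] -/
theorem exists_margin_periodize (hL : 0 < L) {φ : ℝ³ → ℝ} (hφ : IsTestFunctionOn (cylinderCell L) φ) :
    ∃ δ : ℝ, 0 < δ ∧ ∀ a : ℝ, |a| < δ → ∀ x ∈ (cylinderCell L : Set ℝ³),
      φ (x - a • eZ) = periodize L φ (x - a • eZ) := by
  obtain ⟨δ, hδ, hmargin⟩ := exists_axial_margin hφ.hasCompactSupport hφ.tsupport_subset
  refine ⟨δ, hδ, fun a ha x hx => ?_⟩
  have hx2 : x 2 ∈ Ioo 0 L := hx.2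
  have hy2 : (x - a • eZ) 2 = x 2 - a := by simp
  by_cases hcell : x - a • eZ ∈ (cylinderCell L : Set ℝ³)
  · rw [periodize_eq_self hL φ hcell]
  · -- `x - a e_z` is not in the cell: its axial coordinate is within `|a| < δ` of a face
    have hr : cylRadius (x - a • eZ) < 1 := by
      rw [sub_eq_add_neg, ← neg_smul, cylRadius_add_smul_eZ]; exact hx.1
    have hz : (x - a • eZ) 2 ∉ Ioo 0 L := fun h => hcell ⟨hr, h⟩
    rw [hy2] at hz
    -- both sides vanish
    have hφ0 : φ (x - a • eZ) = 0 := by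
      apply image_eq_zero_of_notMem_tsupport
      intro hmem
      exact hcell (hφ.tsupport_subset hmem)
    have hφ0' : periodize L φ (x - a • eZ) = 0 := by
      simp only [periodize]
      apply image_eq_zero_of_notMem_tsupport
      intro hmem
      have hm := hmargin _ hmem
      rw [axialRed_apply_two, hy2] at hm
      have habs := abs_lt.1 ha
      -- `x 2 - a ∈ (-δ, 0] ∪ [L, L + δ)`; its reduction is in `(L - δ, L) ∪ [0, δ)`
      rcases not_and_or.1 (fun h => hz h) with hle | hge
      · -- `x 2 - a ≤ 0`
        have hle' : x 2 - a ≤ 0 := not_lt.1 hle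
        have hgt : -L < x 2 - a := by linarith [hx2.1, habs.2, hδ.le, hmargin _ hmem]
        have hfl : ⌊(x 2 - a) / L⌋ = -1 ∨ x 2 - a = 0 := by
          rcases hle'.lt_or_eq with hlt | heq
          · left
            rw [Int.floor_eq_iff]
            constructor
            · push_cast; rw [le_div_iff₀ hL]; linarith
            · push_cast; rw [div_lt_iff₀ hL]; linarith
          · right; exact heq
        rcases hfl with hfl | hzero
        · rw [hfl] at hm
          push_cast at hm
          linarith [hm.2, habs.1, hx2.1]
        · rw [hzero, zero_div, Int.floor_zero] at hm
          push_cast at hm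
          linarith [hm.1]
      · -- `L ≤ x 2 - a`
        have hge' : L ≤ x 2 - a := not_lt.1 hge
        have hlt2 : x 2 - a < 2 * L := by linarith [hx2.2, habs.1, hmargin _ hmem]
        have hfl : ⌊(x 2 - a) / L⌋ = 1 := by
          rw [Int.floor_eq_iff]
          constructor
          · push_cast; rw [le_div_iff₀ hL]; linarith
          · push_cast; rw [div_lt_iff₀ hL]; linarith
        rw [hfl] at hm
        push_cast at hm
        linarith [hm.1, habs.2, hx2.2]
    rw [hφ0, hφ0']

/-- **Transfer of the periodic shift** [the change of variables behind Nirenberg's quotients]: for a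
test function `φ` on the cell, `|a|` small and every `f ∈ L²(cell; E)`,
`∫_cell φ(x − a e_z) • f(x) dx = ∫_cell φ(x) • (U_a f)(x) dx`. [folklore] -/
theorem exists_forall_setIntegral_comp_sub_smul [NormedSpace ℝ E] (hL : 0 < L) {φ : ℝ³ → ℝ}
    (hφ : IsTestFunctionOn (cylinderCell L) φ) :
    ∃ δ : ℝ, 0 < δ ∧ ∀ a : ℝ, |a| < δ → ∀ f : Lp E 2 (cellMeasure L),
      ∫ x in (cylinderCell L : Set ℝ³), φ (x - a • eZ) • f x =
        ∫ x in (cylinderCell L : Set ℝ³), φ x • (axialShiftLp L a f) x := by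
  obtain ⟨δ, hδ, hmargin⟩ := exists_margin_periodize hL hφ
  refine ⟨δ, hδ, fun a ha f => ?_⟩
  have hψper : IsAxiallyPeriodic L (periodize L φ) := isAxiallyPeriodic_periodize hL φ
  have hψc : Continuous (periodize L φ) := (contDiff_periodize hL hφ).continuous
  -- replace `φ(x - a e_z)` by `ψ(τ_{-a} x)` on the cell, `ψ` the periodisation
  have h1 : ∫ x in (cylinderCell L : Set ℝ³), φ (x - a • eZ) • f x =
      ∫ x in (cylinderCell L : Set ℝ³), periodize L φ (cellShift L (-a) x) • f x := by
    refine setIntegral_congr_fun (cylinderCell L).isOpen.measurableSet fun x hx => ?_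
    rw [hmargin a ha x hx, hψper.comp_cellShift, neg_smul, ← sub_eq_add_neg]
  rw [h1]
  -- change variables `x = τ_a y`
  have hF : AEStronglyMeasurable (fun x => periodize L φ (cellShift L (-a) x) • (f : ℝ³ → E) x)
      (cellMeasure L) :=
    (hψc.comp_aestronglyMeasurable (measurable_cellShift (-a)).aestronglyMeasurable).smul
      (Lp.aestronglyMeasurable f)
  rw [← integral_comp_cellShift hL a hF]
  refine integral_congr_ae ?_
  filter_upwards [coeFn_axialShiftLp hL a f, ae_restrict_mem (cylinderCell L).isOpen.measurableSet]
    with y hy hyc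
  have hcs : cellShift L (-a) (cellShift L a y) = y := by
    rw [cellShift_cellShift hL (-a) a, add_neg_cancel, cellShift_apply, zero_smul, add_zero,
      axialRed_eq_self_of_mem_cell hL hyc]
  rw [hcs, hy, periodize_eq_self hL φ hyc]

/-- **Transfer of the rotation**: `∫_cell φ(R_{−θ} x) • f(x) dx = ∫_cell φ(y) • (R_θ f)(y) dy` for
every continuous `φ` and `f ∈ L²(cell; E)` (no margin: rotations preserve the cell). [folklore] -/
theorem setIntegral_comp_rotZ_neg_smul [NormedSpace ℝ E] {φ : ℝ³ → ℝ} (hφc : Continuous φ) (θ : ℝ)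
    (f : Lp E 2 (cellMeasure L)) :
    ∫ x in (cylinderCell L : Set ℝ³), φ (rotZ (-θ) x) • f x =
      ∫ x in (cylinderCell L : Set ℝ³), φ x • (rotLp L θ f) x := by
  have hF : AEStronglyMeasurable (fun x => φ (rotZ (-θ) x) • (f : ℝ³ → E) x) (cellMeasure L) :=
    (hφc.comp (rotZL (-θ)).continuous).aestronglyMeasurable.smul (Lp.aestronglyMeasurable f)
  rw [← integral_comp_rotZ_cell θ hF]
  refine integral_congr_ae ?_
  filter_upwards [coeFn_rotLp θ f] with y hy
  rw [hy, ← rotZ_add, neg_add_cancel, rotZ_zero]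

/-! ### From `L²`-convergent difference quotients to weak derivatives -/

/-- **Weak axial derivative from convergent difference quotients.** If `aₙ → 0`, `aₙ ≠ 0`, and
`aₙ⁻¹ (U_{aₙ} f − f) → f'` in `L²(cell; E)`, then `f'` is a weak derivative of `f` along `e_z` on the
open cell. Proof: against a test function `φ`, `∫ ψₙ • f → ∫ (∂_z φ) • f` for the quotients
`ψₙ = (φ − φ(· − aₙ e_z))/aₙ` (dominated convergence), while by the transfer of the shift
`∫ ψₙ • f = −∫ φ • aₙ⁻¹(U_{aₙ} f − f) → −∫ φ • f'`. [folklore] -/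
theorem hasWeakDerivAlong_eZ_of_tendsto [NormedSpace ℝ E] [CompleteSpace E] (hL : 0 < L) (f f' : Lp E 2 (cellMeasure L))
    {a : ℕ → ℝ} (ha0 : ∀ n, a n ≠ 0) (ha : Tendsto a atTop (𝓝 0))
    (hlim : Tendsto (fun n => (a n)⁻¹ • (axialShiftLp L (a n) f - f)) atTop (𝓝 f')) :
    HasWeakDerivAlong (cylinderCell L) volume (fun _ => eZ) (f : ℝ³ → E) (f' : ℝ³ → E) where
  locallyIntegrableOn :=
    (show IntegrableOn (f : ℝ³ → E) (cylinderCell L : Set ℝ³) volume from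
      (Lp.memLp f).integrable one_le_two).locallyIntegrableOn
  locallyIntegrableOn_deriv :=
    (show IntegrableOn (f' : ℝ³ → E) (cylinderCell L : Set ℝ³) volume from
      (Lp.memLp f').integrable one_le_two).locallyIntegrableOn
  integral_eq φ hφ := by
    simp only [HasWeakDerivAlong.divergence_const_field, zero_mul, add_zero]
    have hφd : Differentiable ℝ φ := hφ.contDiff.differentiable (by simp)
    obtain ⟨M, hM0, hM⟩ := exists_forall_norm_fderiv_le hφ.contDiff hφ.hasCompactSupport
    -- the quotients `ψ n`
    set ψ : ℕ → ℝ³ → ℝ := fun n x => (φ x - φ (x - a n • eZ)) / a n with hψ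
    have hψc : ∀ n, Continuous (ψ n) := fun n =>
      ((hφ.contDiff.continuous).sub (hφ.contDiff.continuous.comp (continuous_id.sub continuous_const))).div_const _
    -- (1) `∫ ψₙ • f → ∫ (∂_z φ) • f`
    have hfint : Integrable (f : ℝ³ → E) (cellMeasure L) := (Lp.memLp f).integrable one_le_two
    have h1 : Tendsto (fun n => ∫ x in (cylinderCell L : Set ℝ³), ψ n x • (f : ℝ³ → E) x) atTop
        (𝓝 (∫ x in (cylinderCell L : Set ℝ³), (fderiv ℝ φ x eZ) • (f : ℝ³ → E) x)) := by
      refine tendsto_integral_of_dominated_convergence (fun x => M * 1 * ‖(f : ℝ³ → E) x‖)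
        (fun n => (hψc n).aestronglyMeasurable.smul (Lp.aestronglyMeasurable f)) (hfint.norm.const_mul _)
        (fun n => Eventually.of_forall fun x => ?_) (Eventually.of_forall fun x => ?_)
      · rw [norm_smul, Real.norm_eq_abs]
        refine mul_le_mul_of_nonneg_right ?_ (norm_nonneg _)
        have := abs_diffQuot_comp_curve_le hφd hM (γ := fun s => x + s • eZ) (V := 1)
          (fun s => ((differentiableAt_id.smul_const _).const_add _)) (fun s => ?_) (ha0 n)
        · simp only [hψ, zero_smul, add_zero, neg_smul, ← sub_eq_add_neg, mul_one] at this ⊢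
          exact this
        · have hd : HasDerivAt (fun s : ℝ => x + s • eZ) eZ s := by
            simpa using ((hasDerivAt_id s).smul_const (eZ : ℝ³)).const_add x
          rw [hd.deriv, eZ_eq_single, PiLp.norm_single, norm_one]
      · have hq := tendsto_diffQuot_comp_curve hφd (x := x) (γ := fun s => x + s • eZ) (v := eZ)
          (by simp) (by simpa using ((hasDerivAt_id (0 : ℝ)).smul_const (eZ : ℝ³)).const_add x)
        have ha' : Tendsto a atTop (𝓝[≠] 0) :=
          tendsto_nhdsWithin_iff.2 ⟨ha, Eventually.of_forall fun n => ha0 n⟩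
        have := (hq.comp ha').smul_const ((f : ℝ³ → E) x)
        refine this.congr fun n => ?_
        simp [hψ, sub_eq_add_neg]
    -- (2) `∫ ψₙ • f = -∫ φ • aₙ⁻¹(U_{aₙ} f − f)` eventually
    obtain ⟨δ, hδ, htrans⟩ := exists_forall_setIntegral_comp_sub_smul (E := E) hL hφ
    have hsmall : ∀ᶠ n in atTop, |a n| < δ := by
      have := ha.abs
      rw [abs_zero] at this
      exact (this.eventually (gt_mem_nhds hδ))
    have hφint : ∀ w : Lp E 2 (cellMeasure L), Integrable (fun x => φ x • (w : ℝ³ → E) x) (cellMeasure L) :=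
      fun w => HasWeakDerivAlong.integrableOn_smul hφ
        (show IntegrableOn (w : ℝ³ → E) (cylinderCell L : Set ℝ³) volume from
          (Lp.memLp w).integrable one_le_two).locallyIntegrableOn
    have hφint' : Integrable (fun x => φ (x - 0 • eZ) • (f : ℝ³ → E) x) (cellMeasure L) := by
      simpa using hφint f
    have h2 : ∀ᶠ n in atTop, ∫ x in (cylinderCell L : Set ℝ³), ψ n x • (f : ℝ³ → E) x =
        -∫ x in (cylinderCell L : Set ℝ³), φ x •
          (((a n)⁻¹ • (axialShiftLp L (a n) f - f) : Lp E 2 (cellMeasure L)) : ℝ³ → E) x := by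
      filter_upwards [hsmall] with n hn
      have hshift := htrans (a n) hn f
      have hint2 : Integrable (fun x => φ (x - a n • eZ) • (f : ℝ³ → E) x) (cellMeasure L) := by
        have hmem : MemLp (fun x => φ (x - a n • eZ)) ∞ (cellMeasure L) := by
          obtain ⟨B, hB⟩ := hφ.hasCompactSupport.exists_bound_of_continuous hφ.contDiff.continuous
          exact memLp_top_of_bound ((hφ.contDiff.continuous.comp
            (continuous_id.sub continuous_const)).aestronglyMeasurable) B
            (Eventually.of_forall fun x => hB _)
        exact hfint.smul_of_top_right hmem
      -- expand `ψ n`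
      have hexp : ∫ x in (cylinderCell L : Set ℝ³), ψ n x • (f : ℝ³ → E) x =
          (a n)⁻¹ • ((∫ x in (cylinderCell L : Set ℝ³), φ x • (f : ℝ³ → E) x) -
            ∫ x in (cylinderCell L : Set ℝ³), φ (x - a n • eZ) • (f : ℝ³ → E) x) := by
        rw [← integral_sub (hφint f) hint2, ← integral_smul]
        refine integral_congr_ae (Eventually.of_forall fun x => ?_)
        simp only [hψ, ← sub_smul, smul_smul, div_eq_inv_mul]
      rw [hexp, hshift, ← integral_sub (hφint f) (hφint _), ← integral_smul, ← integral_neg]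
      refine integral_congr_ae ?_
      filter_upwards [Lp.coeFn_smul (a n)⁻¹ (axialShiftLp L (a n) f - f),
        Lp.coeFn_sub (axialShiftLp L (a n) f) f] with x hx1 hx2
      rw [hx1, Pi.smul_apply, hx2, Pi.sub_apply]
      module
    -- (3) the right side converges to `-∫ φ • f'`
    obtain ⟨B, hB⟩ := hφ.hasCompactSupport.exists_bound_of_continuous hφ.contDiff.continuous
    have h3 : Tendsto (fun n => -∫ x in (cylinderCell L : Set ℝ³), φ x •
          (((a n)⁻¹ • (axialShiftLp L (a n) f - f) : Lp E 2 (cellMeasure L)) : ℝ³ → E) x) atTop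
        (𝓝 (-∫ x in (cylinderCell L : Set ℝ³), φ x • (f' : ℝ³ → E) x)) :=
      (tendsto_setIntegral_smul_of_tendsto (hφ.contDiff.continuous.aestronglyMeasurable)
        (fun x => by rw [← Real.norm_eq_abs]; exact hB x) hlim).neg
    have h1' := h1.congr' h2
    exact tendsto_nhds_unique h1' h3

/-- **Weak rotational derivative from convergent difference quotients.** If `θₙ → 0`, `θₙ ≠ 0`,
and `θₙ⁻¹ (R_{θₙ} f − f) → f'` in `L²(cell; E)` (scalar action `R_θ f = f ∘ R_θ`), then `f'` is a weak
derivative of `f` along the rotation generator `J x = (−x₁, x₀, 0)` on the open cell. [folklore] -/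
theorem hasWeakDerivAlong_rotGen_of_tendsto [NormedSpace ℝ E] [CompleteSpace E] (f f' : Lp E 2 (cellMeasure L))
    {θ : ℕ → ℝ} (hθ0 : ∀ n, θ n ≠ 0) (hθ : Tendsto θ atTop (𝓝 0))
    (hlim : Tendsto (fun n => (θ n)⁻¹ • (rotLp L (θ n) f - f)) atTop (𝓝 f')) :
    HasWeakDerivAlong (cylinderCell L) volume rotGen (f : ℝ³ → E) (f' : ℝ³ → E) where
  locallyIntegrableOn :=
    (show IntegrableOn (f : ℝ³ → E) (cylinderCell L : Set ℝ³) volume from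
      (Lp.memLp f).integrable one_le_two).locallyIntegrableOn
  locallyIntegrableOn_deriv :=
    (show IntegrableOn (f' : ℝ³ → E) (cylinderCell L : Set ℝ³) volume from
      (Lp.memLp f').integrable one_le_two).locallyIntegrableOn
  integral_eq φ hφ := by
    simp only [divergence_rotGen_eq_zero, zero_mul, add_zero]
    have hφd : Differentiable ℝ φ := hφ.contDiff.differentiable (by simp)
    obtain ⟨M, hM0, hM⟩ := exists_forall_norm_fderiv_le hφ.contDiff hφ.hasCompactSupport
    set ψ : ℕ → ℝ³ → ℝ := fun n x => (φ x - φ (rotZ (-θ n) x)) / θ n with hψ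
    have hψc : ∀ n, Continuous (ψ n) := fun n =>
      ((hφ.contDiff.continuous).sub (hφ.contDiff.continuous.comp (rotZL (-θ n)).continuous)).div_const _
    have hfint : Integrable (f : ℝ³ → E) (cellMeasure L) := (Lp.memLp f).integrable one_le_two
    -- (1) dominated convergence: the orbit `s ↦ R_s x` has speed `r(x) < 1` on the cell
    have hrot : ∀ (s : ℝ) (x : ℝ³), -Real.sin s • (toLp 2 ![x 0, x 1, 0] : ℝ³) + Real.cos s • rotGen x =
        rotGen (rotZ s x) := fun s x => by
      ext i; fin_cases i <;> simp [rotGen] <;> ring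
    have h1 : Tendsto (fun n => ∫ x in (cylinderCell L : Set ℝ³), ψ n x • (f : ℝ³ → E) x) atTop
        (𝓝 (∫ x in (cylinderCell L : Set ℝ³), (fderiv ℝ φ x (rotGen x)) • (f : ℝ³ → E) x)) := by
      refine tendsto_integral_of_dominated_convergence (fun x => M * 1 * ‖(f : ℝ³ → E) x‖)
        (fun n => (hψc n).aestronglyMeasurable.smul (Lp.aestronglyMeasurable f)) (hfint.norm.const_mul _)
        (fun n => ?_) ?_
      · filter_upwards [ae_restrict_mem (cylinderCell L).isOpen.measurableSet] with x hx
        rw [norm_smul, Real.norm_eq_abs]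
        refine mul_le_mul_of_nonneg_right ?_ (norm_nonneg _)
        have hγ : ∀ s, HasDerivAt (fun s => rotZ s x) (-Real.sin s • (toLp 2 ![x 0, x 1, 0] : ℝ³) +
            Real.cos s • rotGen x) s := fun s => hasDerivAt_rotZ x s
        have := abs_diffQuot_comp_curve_le hφd hM (γ := fun s => rotZ s x) (V := 1)
          (fun s => (hγ s).differentiableAt) (fun s => ?_) (hθ0 n)
        · simpa [rotZ_zero] using this
        · rw [(hγ s).deriv, hrot, norm_rotGen_eq_cylRadius, cylRadius_rotZ]
          exact hx.1.le
      · refine Eventually.of_forall fun x => ?_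
        have hq := tendsto_diffQuot_comp_curve hφd (x := x) (γ := fun s => rotZ s x) (v := rotGen x)
          (rotZ_zero x) (hasDerivAt_rotZ_zero x)
        have hθ' : Tendsto θ atTop (𝓝[≠] 0) :=
          tendsto_nhdsWithin_iff.2 ⟨hθ, Eventually.of_forall fun n => hθ0 n⟩
        exact ((hq.comp hθ').smul_const ((f : ℝ³ → E) x)).congr fun n => rfl
    -- (2) transfer of the rotation
    have hφint : ∀ w : Lp E 2 (cellMeasure L), Integrable (fun x => φ x • (w : ℝ³ → E) x) (cellMeasure L) :=
      fun w => HasWeakDerivAlong.integrableOn_smul hφ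
        (show IntegrableOn (w : ℝ³ → E) (cylinderCell L : Set ℝ³) volume from
          (Lp.memLp w).integrable one_le_two).locallyIntegrableOn
    obtain ⟨B, hB⟩ := hφ.hasCompactSupport.exists_bound_of_continuous hφ.contDiff.continuous
    have h2 : ∀ n, ∫ x in (cylinderCell L : Set ℝ³), ψ n x • (f : ℝ³ → E) x =
        -∫ x in (cylinderCell L : Set ℝ³), φ x •
          (((θ n)⁻¹ • (rotLp L (θ n) f - f) : Lp E 2 (cellMeasure L)) : ℝ³ → E) x := fun n => by
      have hshift := setIntegral_comp_rotZ_neg_smul (E := E) (L := L) hφ.contDiff.continuous (θ n) f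
      have hint2 : Integrable (fun x => φ (rotZ (-θ n) x) • (f : ℝ³ → E) x) (cellMeasure L) := by
        have hmem : MemLp (fun x => φ (rotZ (-θ n) x)) ∞ (cellMeasure L) :=
          memLp_top_of_bound ((hφ.contDiff.continuous.comp (rotZL (-θ n)).continuous).aestronglyMeasurable)
            B (Eventually.of_forall fun x => hB _)
        exact hfint.smul_of_top_right hmem
      have hexp : ∫ x in (cylinderCell L : Set ℝ³), ψ n x • (f : ℝ³ → E) x =
          (θ n)⁻¹ • ((∫ x in (cylinderCell L : Set ℝ³), φ x • (f : ℝ³ → E) x) -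
            ∫ x in (cylinderCell L : Set ℝ³), φ (rotZ (-θ n) x) • (f : ℝ³ → E) x) := by
        rw [← integral_sub (hφint f) hint2, ← integral_smul]
        refine integral_congr_ae (Eventually.of_forall fun x => ?_)
        simp only [hψ, ← sub_smul, smul_smul, div_eq_inv_mul]
      rw [hexp, hshift, ← integral_sub (hφint f) (hφint _), ← integral_smul, ← integral_neg]
      refine integral_congr_ae ?_
      filter_upwards [Lp.coeFn_smul (θ n)⁻¹ (rotLp L (θ n) f - f),
        Lp.coeFn_sub (rotLp L (θ n) f) f] with x hx1 hx2
      rw [hx1, Pi.smul_apply, hx2, Pi.sub_apply]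
      module
    have h3 : Tendsto (fun n => -∫ x in (cylinderCell L : Set ℝ³), φ x •
          (((θ n)⁻¹ • (rotLp L (θ n) f - f) : Lp E 2 (cellMeasure L)) : ℝ³ → E) x) atTop
        (𝓝 (-∫ x in (cylinderCell L : Set ℝ³), φ x • (f' : ℝ³ → E) x)) :=
      (tendsto_setIntegral_smul_of_tendsto (hφ.contDiff.continuous.aestronglyMeasurable)
        (fun x => by rw [← Real.norm_eq_abs]; exact hB x) hlim).neg
    have h1' := h1.congr (fun n => h2 n)
    exact tendsto_nhds_unique h1' h3

end PeriodicCylinder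

end Literature.Analysis.FluidPDE
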